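import Literature.MathematicalPhysics.KineticTheory.ZeroFrequencyRingOperator
import Literature.Analysis.UnboundedOperators.LinearizedBoltzmannGainForms
import Literature.Analysis.FluidPDE.HardSphereRegularGeometry
import HarnessLib

/-!
# Route JParityClosure · item FirstOrderOddResponse: exchange symmetry of the ring pair correlation

Support lemmas (`--supports stmt-AtomisticToContinuum-14620`) for the still-untyped layer-2 item
`FirstOrderOddResponse` of route `JParityClosure` (`AtomisticToContinuum/HydrodynamicLimit`), sibling
of `JParityClosureFirstOrderOddResponseParity.lean` (same coordinates `q = ((v, w), ω)`, contact datum
`Rd[h] q = ringPairCorrelation σ z h (-(σ • ω)) (v, w)`, inverse collision `J q = (collide ω (v,w), -ω)`,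
particle exchange `T₂ q = ((w, v), -ω)`).

The informal item's consequence "odd flux ≤ κ · even production to first order in the density" pairs
the J-odd contact datum `Ra = ½(Rd - Rd∘J)` with the collision bracket `h' + h_*' - h - h_*` against
`B M M_* dv dw dω`. Reducing that pairing to the quadratic form `⟨h, R₁(0) h⟩_M` of the zero-frequency
ring operator (the recommended typed form of the item, see the TYPING-MEMO attached to stmt-14620) uses
three unconditional identities, proved here, and one Fubini step (not here):

1. `ringPairCorrelation_neg_swap`: **particle-exchange symmetry** of the first-order pair correlation,
   `γ⁽¹⁾[h](-ρ, (w, v)) = γ⁽¹⁾[h](ρ, (v, w))` — from the same symmetry of the two-body term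
   (`pastEncounterOp_neg_swap`) and of the third-body operator (`pairEnskogOp_neg_swap`), all at the
   level of integrands (no integrability needed); hence the contact datum and its J-odd part are
   `T₂`-invariant (`contactDatum_swap_negDir`, `oddPart_swap_negDir`, using `J T₂ = T₂ J`).
2. `oddPart_comp_collide_negDir`: `Ra (J q) = -Ra q` (J is an involution).
3. `integral_collisionDensity_mul_comp_collide_negDir` / `…_comp_swap_negDir`: the Bochner change of
   variables `∫ B M M_* f(J q) = ∫ B M M_* f(q)` and `∫ B M M_* f(T₂ q) = ∫ B M M_* f(q)` for EVERY `f`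
   (no integrability: `J`, `T₂` are measure-preserving measurable involutions fixing `B M M_*`), whence
   `integral_collisionDensity_mul_oddPart_mul_comp`: `∫ B M M_* Ra(q) G(J q) = -∫ B M M_* Ra(q) G(q)` —
   with `G = h ⊕ h` this is "`∫ BMM Ra (h' + h_*') = -∫ BMM Ra (h + h_*)`", the gain half of the odd
   flux equals minus its loss half — and `integral_collisionDensity_mul_snd_eq_fst`:
   `∫ B M M_* S(q) h(w) = ∫ B M M_* S(q) h(v)` for `T₂`-invariant `S` (e.g. `S = Ra[h]`).

References: van Noije–Ernst 1998 (12), (26)–(27); CIP 1994 §3.1 (the involutions `T₁`, `T₂`).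
-/

open MeasureTheory Metric Real ProbabilityTheory Module
open scoped InnerProductSpace ENNReal

namespace Summit.AtomisticToContinuum.HydrodynamicLimit.Theorems

open Literature.Analysis.UnboundedOperators Literature.MathematicalPhysics.KineticTheory
  Literature.Analysis.FluidPDE

noncomputable section

variable {E : Type*} [NormedAddCommGroup E] [InnerProductSpace ℝ E]

/-! ### 1. Particle-exchange symmetry `(ρ, v, w) ↦ (-ρ, w, v)` -/

section Exchange

omit [InnerProductSpace ℝ E] in
/-- The overlap function is even: `W(-x) = W(x)`. [folklore] -/
theorem overlapFn_neg (σ : ℝ) (x : E) : overlapFn σ (-x) = overlapFn σ x := by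
  simp only [overlapFn, norm_neg]

/-- The collision-cylinder discriminant is invariant under `(ρ, g) ↦ (-ρ, -g)`. [folklore] -/
theorem encounterDiscr_neg_neg (σ : ℝ) (ρ g : E) :
    encounterDiscr σ (-ρ) (-g) = encounterDiscr σ ρ g := by
  simp only [encounterDiscr, inner_neg_left, inner_neg_right, neg_neg, norm_neg]

/-- The backward entry time is invariant under `(ρ, g) ↦ (-ρ, -g)`. [folklore] -/
theorem backwardEntryTime_neg_neg (σ : ℝ) (ρ g : E) :
    backwardEntryTime σ (-ρ) (-g) = backwardEntryTime σ ρ g := by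
  simp only [backwardEntryTime, encounterDiscr_neg_neg, inner_neg_left, inner_neg_right, neg_neg,
    norm_neg]

/-- The backward exit time is invariant under `(ρ, g) ↦ (-ρ, -g)`. [folklore] -/
theorem backwardExitTime_neg_neg (σ : ℝ) (ρ g : E) :
    backwardExitTime σ (-ρ) (-g) = backwardExitTime σ ρ g := by
  simp only [backwardExitTime, encounterDiscr_neg_neg, inner_neg_left, inner_neg_right, neg_neg,
    norm_neg]

/-- **Exchange symmetry of the two-body dynamic correlation `G_z T̄(12)`.** If the pair observable is
exchange-symmetric, `H (w, v) = H (v, w)` (e.g. `H = h ⊕ h`), then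
`pastEncounterOp σ z H (-ρ) (w, v) = pastEncounterOp σ z H ρ (v, w)`: relabelling the two spheres
reverses the relative position and velocity, leaves the backward contact times unchanged and conjugates
the restitution `reflectVel` by the swap (`reflectVel_neg`, `reflectVel_swap`). [folklore] -/
theorem pastEncounterOp_neg_swap (σ z : ℝ) {H : E × E → ℝ} (hH : ∀ q : E × E, H q.swap = H q)
    (ρ : E) (p : E × E) :
    pastEncounterOp σ z H (-ρ) p.swap = pastEncounterOp σ z H ρ p := by
  obtain ⟨v, w⟩ := p
  have hg : w - v = -(v - w) := (neg_sub v w).symm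
  have hrefl : ∀ t : ℝ, H (reflectVel (-ρ - t • (w - v)) (w, v)) =
      H (reflectVel (ρ - t • (v - w)) (v, w)) := by
    intro t
    have hn : -ρ - t • (w - v) = -(ρ - t • (v - w)) := by rw [hg, smul_neg]; abel
    rw [hn, reflectVel_neg, show ((w, v) : E × E) = ((v, w) : E × E).swap from rfl]
    rw [show ((v, w) : E × E).swap = (((v, w) : E × E).2, ((v, w) : E × E).1) from rfl, reflectVel_swap,
      ← hH]
    rfl
  unfold pastEncounterOp
  simp only [Prod.swap_prod_mk]
  rw [hg, encounterDiscr_neg_neg, backwardEntryTime_neg_neg, backwardExitTime_neg_neg, ← hg, hrefl,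
    show H (w, v) = H (v, w) from hH (v, w)]

/-- **Exchange symmetry of `Λ(1) + Λ(2)`.** If the pair function is exchange-symmetric,
`Ψ (-ρ) (w, v) = Ψ ρ (v, w)`, then so is `pairEnskogOp σ Ψ`: the `T̄(13)`-block at the relabelled
point is the `T̄(23)`-block at the original one and vice versa (`overlapFn` is even). [folklore] -/
theorem pairEnskogOp_neg_swap [FiniteDimensional ℝ E] [MeasurableSpace E] [BorelSpace E] (σ : ℝ)
    {Ψ : E → E × E → ℝ} (hΨ : ∀ (ρ : E) (q : E × E), Ψ (-ρ) q.swap = Ψ ρ q) (ρ : E) (p : E × E) :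
    pairEnskogOp σ Ψ (-ρ) p.swap = pairEnskogOp σ Ψ ρ p := by
  obtain ⟨v, w⟩ := p
  have hΨ' : ∀ (ρ' : E) (a b : E), Ψ (-ρ') (a, b) = Ψ ρ' (b, a) := fun ρ' a b => hΨ ρ' (b, a)
  unfold pairEnskogOp
  simp only [Prod.swap_prod_mk]
  congr 1
  refine integral_congr_ae (Filter.Eventually.of_forall fun u => ?_)
  refine integral_congr_ae (Filter.Eventually.of_forall fun ω => ?_)
  have h1 : -ρ - σ • (ω : E) = -(ρ + σ • (ω : E)) := by abel
  have h2 : -ρ + σ • (ω : E) = -(ρ - σ • (ω : E)) := by abel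
  simp only [h1, h2, overlapFn_neg, hΨ']
  ring

/-- **Exchange symmetry of the first-order pair correlation**:
`ringPairCorrelation σ z h (-ρ) (w, v) = ringPairCorrelation σ z h ρ (v, w)` — the three-body ring
correlation `γ⁽¹⁾[h]` does not depend on which sphere of the pair is called `1` (the backward free
flight of the relabelled pair is the mirror image of the original one). [folklore] -/
theorem ringPairCorrelation_neg_swap [FiniteDimensional ℝ E] [MeasurableSpace E] [BorelSpace E]
    (σ z : ℝ) (h : E → ℝ) (ρ : E) (p : E × E) :
    ringPairCorrelation σ z h (-ρ) p.swap = ringPairCorrelation σ z h ρ p := by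
  have hH : ∀ q : E × E, pairSum h q.swap = pairSum h q := fun q => by
    simp only [pairSum, Prod.fst_swap, Prod.snd_swap, add_comm]
  have hΨ : ∀ (ρ' : E) (q : E × E), pastEncounterOp σ z (pairSum h) (-ρ') q.swap =
      pastEncounterOp σ z (pairSum h) ρ' q := fun ρ' q => pastEncounterOp_neg_swap σ z hH ρ' q
  unfold ringPairCorrelation freeFlightResolvent
  refine integral_congr_ae (Filter.Eventually.of_forall fun t => ?_)
  dsimp only
  have hpos : -ρ - t • (p.swap.1 - p.swap.2) = -(ρ - t • (p.1 - p.2)) := by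
    simp only [Prod.fst_swap, Prod.snd_swap, ← neg_sub p.1 p.2, smul_neg]
    abel
  rw [hpos, pairEnskogOp_neg_swap σ hΨ]

/-- **The contact datum is invariant under particle exchange `T₂ q = ((w, v), -ω)`**:
`Rd (q.1.swap, -q.2) = Rd q` for `Rd q = ringPairCorrelation σ z h (-(σ • q.2)) q.1`. [folklore] -/
theorem contactDatum_swap_negDir [FiniteDimensional ℝ E] [MeasurableSpace E] [BorelSpace E]
    (σ z : ℝ) (h : E → ℝ) (q : (E × E) × sphere (0 : E) 1) :
    (fun q : (E × E) × sphere (0 : E) 1 => ringPairCorrelation σ z h (-(σ • (q.2 : E))) q.1)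
        (q.1.swap, -q.2) =
      (fun q : (E × E) × sphere (0 : E) 1 => ringPairCorrelation σ z h (-(σ • (q.2 : E))) q.1) q := by
  dsimp only
  rw [coe_neg_sphere, smul_neg, ← ringPairCorrelation_neg_swap σ z h (-(σ • (q.2 : E))) q.1, neg_neg]

/-- `J` and `T₂` commute: `collide (-ω) (w, v) = (collide ω (v, w)).swap` (and `-(-ω) = ω`).
[folklore] -/
theorem collide_negDir_swap (ω : sphere (0 : E) 1) (p : E × E) :
    collide (-ω) p.swap = (collide ω p).swap := by
  rw [collide_neg_dir, collide_swap]

/-- **The J-odd part of the contact datum is `T₂`-invariant**: for any `R` on `(E × E) × S^{d-1}`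
with `R (q.1.swap, -q.2) = R q` (e.g. the contact datum, `contactDatum_swap_negDir`), its odd part
`Ra q = (R q - R (collide q.2 q.1, -q.2)) / 2` satisfies `Ra (q.1.swap, -q.2) = Ra q`. [folklore] -/
theorem oddPart_swap_negDir {R : (E × E) × sphere (0 : E) 1 → ℝ}
    (hR : ∀ q : (E × E) × sphere (0 : E) 1, R (q.1.swap, -q.2) = R q)
    (q : (E × E) × sphere (0 : E) 1) :
    (R ((q.1.swap, -q.2) : (E × E) × sphere (0 : E) 1) -
        R (collide (-q.2) q.1.swap, -(-q.2))) / 2 =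
      (R q - R (collide q.2 q.1, -q.2)) / 2 := by
  rw [hR q, collide_negDir_swap, neg_neg]
  have h := hR (collide q.2 q.1, -q.2)
  rw [neg_neg] at h
  rw [h]

/-- **`Ra ∘ J = -Ra`**: the odd part of any `R` changes sign under the inverse collision
(`J ∘ J = id`: `collide (-ω) (collide ω p) = p`). [folklore] -/
theorem oddPart_comp_collide_negDir (R : (E × E) × sphere (0 : E) 1 → ℝ)
    (q : (E × E) × sphere (0 : E) 1) :
    (R ((collide q.2 q.1, -q.2) : (E × E) × sphere (0 : E) 1) -
        R (collide (-q.2) (collide q.2 q.1), -(-q.2))) / 2 =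
      -((R q - R (collide q.2 q.1, -q.2)) / 2) := by
  rw [collide_neg_dir, collide_collide, neg_neg]
  ring

end Exchange

/-! ### 2. Bochner change of variables under `J` and `T₂` (no integrability needed) -/

section ChangeOfVariables

variable [FiniteDimensional ℝ E] [MeasurableSpace E] [BorelSpace E]

/-- **`∫ B M M_* · f ∘ J = ∫ B M M_* · f`** for EVERY real function `f` on `(E × E) × S^{d-1}` (Bochner
integrals, both sides junk `0` together): `J q = (collide q.2 q.1, -q.2)` is a measure-preserving
measurable involution of `dv dw dω` fixing `collisionDensity`. [folklore] -/
theorem integral_collisionDensity_mul_comp_collide_negDir (f : (E × E) × sphere (0 : E) 1 → ℝ) :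
    ∫ q, collisionDensity q * f (collide q.2 q.1, -q.2)
        ∂(((volume : Measure E).prod volume).prod sphereMeasure) =
      ∫ q, collisionDensity q * f q ∂(((volume : Measure E).prod volume).prod sphereMeasure) := by
  have hT := measurePreserving_collide_negDir (E := E)
  let J : (E × E) × sphere (0 : E) 1 ≃ᵐ (E × E) × sphere (0 : E) 1 :=
    { toFun := fun q => (collide q.2 q.1, -q.2)
      invFun := fun q => (collide q.2 q.1, -q.2)
      left_inv := fun q => by simp [collide_neg_dir, collide_collide]
      right_inv := fun q => by simp [collide_neg_dir, collide_collide]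
      measurable_toFun := hT.measurable
      measurable_invFun := hT.measurable }
  have hJ : MeasurableEmbedding (fun q : (E × E) × sphere (0 : E) 1 => (collide q.2 q.1, -q.2)) :=
    J.measurableEmbedding
  calc ∫ q, collisionDensity q * f (collide q.2 q.1, -q.2)
          ∂(((volume : Measure E).prod volume).prod sphereMeasure)
      = ∫ q, (fun q' => collisionDensity q' * f q') (collide q.2 q.1, -q.2)
          ∂(((volume : Measure E).prod volume).prod sphereMeasure) := by
        refine integral_congr_ae (Filter.Eventually.of_forall fun q => ?_)
        simp only [collisionDensity_collide_negDir]
    _ = _ := hT.integral_comp hJ (fun q' => collisionDensity q' * f q')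

/-- **`∫ B M M_* · f ∘ T₂ = ∫ B M M_* · f`** for EVERY real `f`: the particle exchange
`T₂ q = (q.1.swap, -q.2)` is a measure-preserving measurable involution of `dv dw dω`
(`measurePreserving_swap_negDir`) fixing `collisionDensity` (`collisionDensity_swap_negDir`).
[folklore] -/
theorem integral_collisionDensity_mul_comp_swap_negDir (f : (E × E) × sphere (0 : E) 1 → ℝ) :
    ∫ q, collisionDensity q * f (q.1.swap, -q.2)
        ∂(((volume : Measure E).prod volume).prod sphereMeasure) =
      ∫ q, collisionDensity q * f q ∂(((volume : Measure E).prod volume).prod sphereMeasure) := by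
  have hT := measurePreserving_swap_negDir (E := E)
  let T : (E × E) × sphere (0 : E) 1 ≃ᵐ (E × E) × sphere (0 : E) 1 :=
    { toFun := fun q => (q.1.swap, -q.2)
      invFun := fun q => (q.1.swap, -q.2)
      left_inv := fun q => by simp
      right_inv := fun q => by simp
      measurable_toFun := hT.measurable
      measurable_invFun := hT.measurable }
  have hTe : MeasurableEmbedding (fun q : (E × E) × sphere (0 : E) 1 => (q.1.swap, -q.2)) :=
    T.measurableEmbedding
  calc ∫ q, collisionDensity q * f (q.1.swap, -q.2)
          ∂(((volume : Measure E).prod volume).prod sphereMeasure)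
      = ∫ q, (fun q' => collisionDensity q' * f q') (q.1.swap, -q.2)
          ∂(((volume : Measure E).prod volume).prod sphereMeasure) := by
        refine integral_congr_ae (Filter.Eventually.of_forall fun q => ?_)
        simp only [collisionDensity_swap_negDir]
    _ = _ := hT.integral_comp hTe (fun q' => collisionDensity q' * f q')

/-- **The gain half of an odd pairing is minus its loss half.** For every `R` and `G` on
`(E × E) × S^{d-1}`, with `Ra q = (R q - R (J q)) / 2`:
`∫ B M M_* Ra(q) G(J q) = -∫ B M M_* Ra(q) G(q)` (unconditionally). With `R` the contact datum of `h`
and `G = h ⊕ h` (so `G ∘ J = h' + h_*'`), the first-order odd flux `∫ BMM Ra (h' + h_*' - h - h_*)`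
is `-2 ∫ BMM Ra (h + h_*)` as soon as one (hence both) of the halves is integrable. [folklore] -/
theorem integral_collisionDensity_mul_oddPart_mul_comp (R G : (E × E) × sphere (0 : E) 1 → ℝ) :
    ∫ q, collisionDensity q * (((R q - R (collide q.2 q.1, -q.2)) / 2) * G (collide q.2 q.1, -q.2))
        ∂(((volume : Measure E).prod volume).prod sphereMeasure) =
      -∫ q, collisionDensity q * (((R q - R (collide q.2 q.1, -q.2)) / 2) * G q)
        ∂(((volume : Measure E).prod volume).prod sphereMeasure) := by
  calc ∫ q, collisionDensity q * (((R q - R (collide q.2 q.1, -q.2)) / 2) * G (collide q.2 q.1, -q.2))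
          ∂(((volume : Measure E).prod volume).prod sphereMeasure)
      = ∫ q, collisionDensity q *
          (fun q' : (E × E) × sphere (0 : E) 1 =>
            (R (collide q'.2 q'.1, -q'.2) -
                R (collide (-q'.2) (collide q'.2 q'.1), -(-q'.2))) / 2 * G q')
            (collide q.2 q.1, -q.2) ∂(((volume : Measure E).prod volume).prod sphereMeasure) := by
        refine integral_congr_ae (Filter.Eventually.of_forall fun q => ?_)
        simp only [collide_neg_dir, collide_collide, neg_neg, Prod.mk.eta]
    _ = ∫ q, collisionDensity q *
          ((R (collide q.2 q.1, -q.2) - R (collide (-q.2) (collide q.2 q.1), -(-q.2))) / 2 * G q)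
          ∂(((volume : Measure E).prod volume).prod sphereMeasure) :=
        integral_collisionDensity_mul_comp_collide_negDir
          (fun q' : (E × E) × sphere (0 : E) 1 =>
            (R (collide q'.2 q'.1, -q'.2) -
                R (collide (-q'.2) (collide q'.2 q'.1), -(-q'.2))) / 2 * G q')
    _ = ∫ q, -(collisionDensity q * (((R q - R (collide q.2 q.1, -q.2)) / 2) * G q))
          ∂(((volume : Measure E).prod volume).prod sphereMeasure) := by
        refine integral_congr_ae (Filter.Eventually.of_forall fun q => ?_)
        simp only [collide_neg_dir, collide_collide, neg_neg, Prod.mk.eta]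
        ring
    _ = _ := integral_neg _

/-- **In a `T₂`-invariant pairing the two particles contribute equally.** If `S (q.1.swap, -q.2) = S q`
(e.g. `S = Ra[h]`, `oddPart_swap_negDir` with `contactDatum_swap_negDir`) then
`∫ B M M_* S(q) h(w) = ∫ B M M_* S(q) h(v)` for every `h` (unconditionally); so
`∫ BMM Ra (h + h_*) = 2 ∫ BMM Ra(q) h(v)`, which by `zeroFrequencyRingOperator_eq_integral_oddPart` and
Fubini is `-σ^{1-d} ⟨h, R₁(0) h⟩_M`. [folklore] -/
theorem integral_collisionDensity_mul_snd_eq_fst {S : (E × E) × sphere (0 : E) 1 → ℝ}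
    (hS : ∀ q : (E × E) × sphere (0 : E) 1, S (q.1.swap, -q.2) = S q) (h : E → ℝ) :
    ∫ q, collisionDensity q * (S q * h q.1.2) ∂(((volume : Measure E).prod volume).prod sphereMeasure) =
      ∫ q, collisionDensity q * (S q * h q.1.1)
        ∂(((volume : Measure E).prod volume).prod sphereMeasure) := by
  rw [← integral_collisionDensity_mul_comp_swap_negDir (fun q => S q * h q.1.1)]
  refine integral_congr_ae (Filter.Eventually.of_forall fun q => ?_)
  dsimp only
  rw [hS q, Prod.fst_swap]

end ChangeOfVariables

end

end Summit.AtomisticToContinuum.HydrodynamicLimit.Theorems
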